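import Summits.QuantumFields.YangMills.Theorems.UnitScaleGibbsOneBondSchwingerDysonMatrix
import HarnessLib

/-!
# The second-order slot calculus of the Wilson plaquette word along a Lie-algebra-valued bond field `u`:
# the action derivative `X_u = ∂_u A` and its derivative `∂_u X_u`, bond by bond and summed (matrix model of the gauge group)

Crux of record `UnitScaleTilt.HistoryTailL` (stmt-QuantumFields-19936), cell `ym3-torus` (YM ladder rung R3 = continuum SU(2) Yang–Mills on T³ —
a RUNG, NOT the Clay problem: not d = 4, not infinite volume, not a mass gap); width seat `ym3-torus-px17` gen 7.  The CALCULUS feeding the rows of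
✓∕⧗ `UnitScaleGibbsSchwingerDysonGaussianDomination` (Gross's Gaussian domination, abstract form) for the observable LINE 28 («gross-sd-transfer», idea card
`Cruxes/HistoryTailL/Ideas/gross-sd-transfer.md`, annexes 1–3, stubs S_SD ∕ S_dom) differentiates: the derivative `X_u = ∂_u A` of Bałaban's Wilson action
`A = wilsonAction4` along the left-invariant vector field generated by a U-INDEPENDENT bond field `u : PBond P j → M_N(ℂ)` (in the application `u_b ∈ 𝔰𝔲(N)`),
in the MATRIX MODEL of ✓ `UnitScaleGibbsOneBondSchwingerDysonMatrix` (seat w8 g9): a monoid homomorphism `ρ : G →* M_N(ℂ)`, `reTr g = Re tr ρ(g) ∕ N`, one-bond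
shifts `U ↦ U[b ↦ k b t · U_b]` with `ρ(k b t) = exp(t·u_b)`, and the SIMULTANEOUS flow `U ↦ (b ↦ k b t · U_b)`.

THE SLOTS.  `ρ(U(∂p)) = S₀S₁S₂S₃` (`word ∘ slot`), `S = (ρU_{e₀}, ρU_{e₁}, ρ(U_{e₂}⁻¹), ρ(U_{e₃}⁻¹))` over the four bonds `slotBond p = (⟨x,μ⟩, ⟨x+e_μ,ν⟩, ⟨x+e_ν,μ⟩, ⟨x,ν⟩)`
of `GaugeField.plaqHol`.  Along `u` a direct slot moves as `exp(t u_e)·ρU_e`, an inverse slot as `ρ(U_e⁻¹)·exp(−t u_e)`; the FIRST INSERTIONS are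
`slotIns = (u₀ρU₀, u₁ρU₁, ρU₂⁻¹(−u₂), ρU₃⁻¹(−u₃))` (✓ `hasDerivAt_factor(_inv)`), the SECOND INSERTIONS (same slot twice) `slotIns₂ = (u₀(u₀ρU₀), …, ρU₂⁻¹(−u₂)(−u₂), …)`.

WHAT IS HERE (ns `…Theorems.UnitScaleGibbsActionDerivativeSlotCalculus`; DEFINITIONS `slotBond slot slotIns slotIns₂ word word₂ actionDeriv oneBondDeriv actionDeriv₂
oneBondDeriv₂ hessianBound` + the slot-level theorems; 0 `sorry`):
* §1 `word`, `rho_plaqHol_eq_word`, `sum_word_update`, `word_update_zero`, ★ `hasDerivAt_word` (4-factor product rule: `Σ_i word(S with slot i replaced by its derivative)`);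
* §2 slot derivatives: one bond (`hasDerivAt_slot_oneBond`, `hasDerivAt_slotIns_oneBond` — with the `if slotBond p i = b` switches) and simultaneous flow (`hasDerivAt_slot_flow`);
* the OBJECTS of the sequel `UnitScaleGibbsActionDerivativeSlotDerivatives` (§3 `hasDerivAt_wilsonAction4_flow`: `X_u := actionDeriv ρ u U
  = Σ_p Σ_{i<4} −Re tr(word(S with slot i ↦ slotIns i)) ∕ N` IS `∂_u A`; the one-bond rows `A′_b = oneBondDeriv ρ u b`, `Σ_b A′_b = X_u`; §4 the one-bond rows
  `X′_b = oneBondDeriv₂ ρ u b` of `X_u` through the 16 double-insertion words `word₂ p i l`, `Σ_b X′_b = actionDeriv₂ ρ u U = Σ_p Σ_{i,l} −Re tr(word₂ p i l) ∕ N`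
  — the Hessian `∂_u∂_u A` as a double slot sum; §5 continuity) are DEFINED here: `word₂ actionDeriv oneBondDeriv actionDeriv₂ oneBondDeriv₂`, and
  `hessianBound u := (Σ_p (Σ_{i<4} ‖u_{slotBond p i}‖_F)²) ∕ N` — the CRUDE configuration-free bound of `|actionDeriv₂|` proved in
  `UnitScaleGibbsActionDerivativeGaussianDomination` (Frobenius norms; `ρ` unitary-valued).

HONEST SCOPE.  Finite-dimensional calculus (product rule, `d∕dt exp(tX) = X`); nothing probabilistic; nothing of S_dom (sharp form), «ShallowFluxSecondMomentL»,
«BlockSecondMomentL», (Q), K1, `MeanDeviationL`, `HistoryTailL`, R3, d = 4, a continuum limit or a mass gap is proved; LINE 28 is an idea, not a line; the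
Yang–Mills mass gap is NOT proved.  `--supports stmt-QuantumFields-19936 --as helper`.

References: M. Creutz, Quarks, Gluons and Lattices (2022) Ch. 11 (link derivatives of plaquette words) [Creutz2022]; S. Chatterjee, CMP 366 (2019) §8 [Chatterjee2019LargeN];
L. Gross, CMP 92 (1983) 137–162, proof of Thm 2.2 (the second derivative `Σ φ_p² h″(F_p)` of the action along the test field) [GrossCMP1983].
-/

set_option autoImplicit false

noncomputable section

open MeasureTheory Filter Topology NormedSpace
open scoped Matrix.Norms.Frobenius BigOperators
open Literature.MathematicalPhysics.QuantumFieldTheory.Balaban1983to89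
open Summit.QuantumFields.YangMills.Theorems.UnitScaleGibbsOneBondSchwingerDyson (update_mul_zero update_mul_flow)
open Summit.QuantumFields.YangMills.Theorems.UnitScaleGibbsOneBondSchwingerDysonMatrix (hasDerivAt_factor hasDerivAt_factor_inv)
open Summit.QuantumFields.YangMills.Cruxes.CurvatureAmnesia.WardDefect.SchwingerDyson (hasDerivAt_exp_coe_smul hasDerivAt_reTrace oneParam_neg)

namespace Summit.QuantumFields.YangMills.Theorems.UnitScaleGibbsActionDerivativeSlotCalculus

/-! ## §1 Words of four matrices and their product rule -/

section Word

variable {N : ℕ}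

/-- The ordered product `S₀S₁S₂S₃` of four matrices (the shape of a plaquette variable in a matrix model). [cite: Creutz2022, Ch. 11] -/
def word (S : Fin 4 → Matrix (Fin N) (Fin N) ℂ) : Matrix (Fin N) (Fin N) ℂ := S 0 * S 1 * S 2 * S 3

/-- The four one-slot replacements, summed: `Σ_i word(S[i ↦ D_i]) = D₀S₁S₂S₃ + S₀D₁S₂S₃ + S₀S₁D₂S₃ + S₀S₁S₂D₃`. [cite: Creutz2022, Ch. 11] -/
theorem sum_word_update (S D : Fin 4 → Matrix (Fin N) (Fin N) ℂ) :
    ∑ i, word (Function.update S i (D i)) =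
      D 0 * S 1 * S 2 * S 3 + S 0 * D 1 * S 2 * S 3 + S 0 * S 1 * D 2 * S 3 + S 0 * S 1 * S 2 * D 3 := by
  simp [Fin.sum_univ_four, word, Function.update_self, Function.update_of_ne]

/-- A word with a zero slot vanishes. [folklore] -/
theorem word_update_zero (S : Fin 4 → Matrix (Fin N) (Fin N) ℂ) (i : Fin 4) : word (Function.update S i 0) = 0 := by
  fin_cases i <;> simp [word]

/-- ★ **THE FOUR-FACTOR PRODUCT RULE**: if every slot `t ↦ S t i` has derivative `D i` at `0`, then `t ↦ word (S t)` has derivative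
`Σ_i word((S 0)[i ↦ D i])`. [cite: Creutz2022, Ch. 11] -/
theorem hasDerivAt_word {S : ℝ → Fin 4 → Matrix (Fin N) (Fin N) ℂ} {D : Fin 4 → Matrix (Fin N) (Fin N) ℂ}
    (h : ∀ i, HasDerivAt (fun t => S t i) (D i) 0) :
    HasDerivAt (fun t => word (S t)) (∑ i, word (Function.update (S 0) i (D i))) 0 := by
  have h4 := (((h 0).mul (h 1)).mul (h 2)).mul (h 3)
  simp only [Pi.mul_apply] at h4
  have hfun : (fun t => word (S t)) = (((fun t => S t 0) * fun t => S t 1) * fun t => S t 2) * fun t => S t 3 := by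
    funext t; simp only [word, Pi.mul_apply]
  rw [hfun, sum_word_update]
  refine h4.congr_deriv ?_
  noncomm_ring

end Word

/-! ## §2 The slots of Bałaban's plaquette word and their derivatives -/

section Slots

variable {N : ℕ} {P : Params} {j : ℕ} {G : Type} [GaugeGroup G]
  (ρ : G →* Matrix (Fin N) (Fin N) ℂ) (u : PBond P j → Matrix (Fin N) (Fin N) ℂ)

/-- The four bonds of the plaquette `p = ⟨x, x+e_μ, x+e_μ+e_ν, x+e_ν⟩` in the order of `GaugeField.plaqHol`: `⟨x,μ⟩, ⟨x+e_μ,ν⟩, ⟨x+e_ν,μ⟩, ⟨x,ν⟩`.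
[cite: Creutz2022, Ch. 11] -/
def slotBond (p : Plaq P j) : Fin 4 → PBond P j :=
  ![⟨p.src, p.μ⟩, ⟨p.src.shift p.μ, p.ν⟩, ⟨p.src.shift p.ν, p.μ⟩, ⟨p.src, p.ν⟩]

/-- The four slot matrices `(ρU_{e₀}, ρU_{e₁}, ρ(U_{e₂}⁻¹), ρ(U_{e₃}⁻¹))` of `ρ(U(∂p))`. [cite: Creutz2022, Ch. 11] -/
def slot (U : GaugeField P j G) (p : Plaq P j) : Fin 4 → Matrix (Fin N) (Fin N) ℂ :=
  ![ρ (U ⟨p.src, p.μ⟩), ρ (U ⟨p.src.shift p.μ, p.ν⟩), ρ ((U ⟨p.src.shift p.ν, p.μ⟩)⁻¹), ρ ((U ⟨p.src, p.ν⟩)⁻¹)]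

/-- The FIRST INSERTIONS along `u`: a direct slot `ρU_e` moves as `exp(t u_e)ρU_e` with derivative `u_e ρU_e`; an inverse slot `ρ(U_e⁻¹)` moves as `ρ(U_e⁻¹)exp(−t u_e)`
with derivative `ρ(U_e⁻¹)(−u_e)`. [cite: Creutz2022, Ch. 11] -/
def slotIns (U : GaugeField P j G) (p : Plaq P j) : Fin 4 → Matrix (Fin N) (Fin N) ℂ :=
  ![u ⟨p.src, p.μ⟩ * ρ (U ⟨p.src, p.μ⟩), u ⟨p.src.shift p.μ, p.ν⟩ * ρ (U ⟨p.src.shift p.μ, p.ν⟩),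
    ρ ((U ⟨p.src.shift p.ν, p.μ⟩)⁻¹) * (-u ⟨p.src.shift p.ν, p.μ⟩), ρ ((U ⟨p.src, p.ν⟩)⁻¹) * (-u ⟨p.src, p.ν⟩)]

/-- The SECOND INSERTIONS (the same slot differentiated twice): `u_e(u_e ρU_e)` resp. `ρ(U_e⁻¹)(−u_e)(−u_e)`. [cite: Creutz2022, Ch. 11] -/
def slotIns₂ (U : GaugeField P j G) (p : Plaq P j) : Fin 4 → Matrix (Fin N) (Fin N) ℂ :=
  ![u ⟨p.src, p.μ⟩ * (u ⟨p.src, p.μ⟩ * ρ (U ⟨p.src, p.μ⟩)),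
    u ⟨p.src.shift p.μ, p.ν⟩ * (u ⟨p.src.shift p.μ, p.ν⟩ * ρ (U ⟨p.src.shift p.μ, p.ν⟩)),
    ρ ((U ⟨p.src.shift p.ν, p.μ⟩)⁻¹) * (-u ⟨p.src.shift p.ν, p.μ⟩) * (-u ⟨p.src.shift p.ν, p.μ⟩),
    ρ ((U ⟨p.src, p.ν⟩)⁻¹) * (-u ⟨p.src, p.ν⟩) * (-u ⟨p.src, p.ν⟩)]

/-- The sixteen DOUBLE-INSERTION WORDS: first insertion at slot `i`, then the derivative of that word's slot `l` (a second insertion at `i` if `l = i`,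
a first insertion at `l` otherwise). [cite: Creutz2022, Ch. 11] -/
def word₂ (U : GaugeField P j G) (p : Plaq P j) (i l : Fin 4) : Matrix (Fin N) (Fin N) ℂ :=
  word (Function.update (Function.update (slot ρ U p) i (slotIns ρ u U p i)) l
    (if l = i then slotIns₂ ρ u U p i else slotIns ρ u U p l))

/-- **THE ACTION DERIVATIVE ALONG `u`**: `X_u(U) = ∂_u A(U) = Σ_p Σ_{i<4} −Re tr(word(slot[i ↦ slotIns i])) ∕ N` (for `A = Σ_p (1 − Re tr ρ(U(∂p))∕N)`;
see `hasDerivAt_wilsonAction4_flow`). [cite: GrossCMP1983, Thm 2.2 (proof)] -/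
def actionDeriv (U : GaugeField P j G) : ℝ :=
  ∑ p : Plaq P j, ∑ i : Fin 4, -((word (Function.update (slot ρ U p) i (slotIns ρ u U p i))).trace.re / N)

variable [DecidableEq (PBond P j)]

/-- The one-bond piece of `X_u`: the terms of `actionDeriv` whose inserted slot carries the bond `b` (= the shift-derivative of `A` along `b` alone,
`hasDerivAt_wilsonAction4_oneBond`). [cite: Creutz2022, Ch. 11] -/
def oneBondDeriv (b : PBond P j) (U : GaugeField P j G) : ℝ :=
  ∑ p : Plaq P j, ∑ i : Fin 4,
    if slotBond p i = b then -((word (Function.update (slot ρ U p) i (slotIns ρ u U p i))).trace.re / N) else 0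

/-- **THE SECOND DERIVATIVE ALONG `u`, SUMMED**: `actionDeriv₂ = Σ_p Σ_{i,l} −Re tr(word₂ p i l) ∕ N = Σ_b ∂_b X_u` (`sum_oneBondDeriv₂`).
[cite: GrossCMP1983, Thm 2.2 (proof)] -/
def actionDeriv₂ (U : GaugeField P j G) : ℝ :=
  ∑ p : Plaq P j, ∑ i : Fin 4, ∑ l : Fin 4, -((word₂ ρ u U p i l).trace.re / N)

/-- The one-bond piece of `actionDeriv₂`: the shift-derivative of `X_u` along the bond `b` (`hasDerivAt_actionDeriv_oneBond`). [cite: Creutz2022, Ch. 11] -/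
def oneBondDeriv₂ (b : PBond P j) (U : GaugeField P j G) : ℝ :=
  ∑ p : Plaq P j, ∑ i : Fin 4, ∑ l : Fin 4,
    if slotBond p l = b then -((word₂ ρ u U p i l).trace.re / N) else 0

omit [GaugeGroup G] [DecidableEq (PBond P j)] in
/-- **THE CRUDE HESSIAN BOUND** `K(u) = (Σ_p (Σ_{i<4} ‖u_{slotBond p i}‖_F)²) ∕ N` (Frobenius norms; bounds `|actionDeriv₂|` when `ρ` is unitary-valued — sequel file).
[cite: GrossCMP1983, Thm 2.2 (proof)] -/
def hessianBound (u : PBond P j → Matrix (Fin N) (Fin N) ℂ) : ℝ :=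
  (∑ p : Plaq P j, (∑ i : Fin 4, ‖u (slotBond p i)‖) ^ 2) / N

omit [DecidableEq (PBond P j)] in
/-- `ρ(U(∂p))` is the word of the four slots. [cite: Creutz2022, Ch. 11] -/
theorem rho_plaqHol_eq_word (U : GaugeField P j G) (p : Plaq P j) :
    ρ (GaugeField.plaqHol U p) = word (slot ρ U p) := by
  simp [GaugeField.plaqHol, word, slot, map_mul]

variable {ρ u} {k : PBond P j → ℝ → G}

/-- One-bond shift: the slot `i` of `p` moves iff its bond is `b`, with derivative the first insertion. [cite: Creutz2022, Ch. 11] -/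
theorem hasDerivAt_slot_oneBond (hk : ∀ b s t, k b (s + t) = k b s * k b t) (hkX : ∀ b t, ρ (k b t) = exp ((t : ℂ) • u b))
    (b : PBond P j) (U : GaugeField P j G) (p : Plaq P j) (i : Fin 4) :
    HasDerivAt (fun t : ℝ => slot ρ (Function.update U b (k b t * U b)) p i)
      (if slotBond p i = b then slotIns ρ u U p i else 0) 0 := by
  fin_cases i
  · have h := hasDerivAt_factor (P := P) (j := j) ρ (k := k b) (X := u b) (hkX b) b ⟨p.src, p.μ⟩ U
    by_cases hb : (⟨p.src, p.μ⟩ : PBond P j) = b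
    · rw [if_pos hb] at h; subst hb; simpa [slot, slotBond, slotIns] using h
    · rw [if_neg hb] at h; simpa [slot, slotBond, slotIns, hb] using h
  · have h := hasDerivAt_factor (P := P) (j := j) ρ (k := k b) (X := u b) (hkX b) b ⟨p.src.shift p.μ, p.ν⟩ U
    by_cases hb : (⟨p.src.shift p.μ, p.ν⟩ : PBond P j) = b
    · rw [if_pos hb] at h; subst hb; simpa [slot, slotBond, slotIns] using h
    · rw [if_neg hb] at h; simpa [slot, slotBond, slotIns, hb] using h
  · have h := hasDerivAt_factor_inv (P := P) (j := j) ρ (k := k b) (X := u b) (hk b) (hkX b) b ⟨p.src.shift p.ν, p.μ⟩ U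
    by_cases hb : (⟨p.src.shift p.ν, p.μ⟩ : PBond P j) = b
    · rw [if_pos hb] at h; subst hb; simpa [slot, slotBond, slotIns] using h
    · rw [if_neg hb] at h; simpa [slot, slotBond, slotIns, hb] using h
  · have h := hasDerivAt_factor_inv (P := P) (j := j) ρ (k := k b) (X := u b) (hk b) (hkX b) b ⟨p.src, p.ν⟩ U
    by_cases hb : (⟨p.src, p.ν⟩ : PBond P j) = b
    · rw [if_pos hb] at h; subst hb; simpa [slot, slotBond, slotIns] using h
    · rw [if_neg hb] at h; simpa [slot, slotBond, slotIns, hb] using h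

/-- One-bond shift of a FIRST insertion: it moves iff its bond is `b`, with derivative the second insertion. [cite: Creutz2022, Ch. 11] -/
theorem hasDerivAt_slotIns_oneBond (hk : ∀ b s t, k b (s + t) = k b s * k b t) (hkX : ∀ b t, ρ (k b t) = exp ((t : ℂ) • u b))
    (b : PBond P j) (U : GaugeField P j G) (p : Plaq P j) (i : Fin 4) :
    HasDerivAt (fun t : ℝ => slotIns ρ u (Function.update U b (k b t * U b)) p i)
      (if slotBond p i = b then slotIns₂ ρ u U p i else 0) 0 := by
  fin_cases i
  · have h : HasDerivAt (fun t : ℝ => u ⟨p.src, p.μ⟩ * ρ (Function.update U b (k b t * U b) ⟨p.src, p.μ⟩))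
        (u ⟨p.src, p.μ⟩ * (if (⟨p.src, p.μ⟩ : PBond P j) = b then u b * ρ (U b) else 0)) 0 :=
      (hasDerivAt_factor (P := P) (j := j) ρ (k := k b) (X := u b) (hkX b) b ⟨p.src, p.μ⟩ U).const_mul _
    show HasDerivAt (fun t : ℝ => slotIns ρ u (Function.update U b (k b t * U b)) p 0) (if slotBond p 0 = b then slotIns₂ ρ u U p 0 else 0) 0
    simp only [slotIns, slotIns₂, slotBond, Matrix.cons_val_zero]
    by_cases hb : (⟨p.src, p.μ⟩ : PBond P j) = b
    · subst hb; rw [if_pos rfl] at h ⊢; exact h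
    · rw [if_neg hb, mul_zero] at h; rw [if_neg hb]; exact h
  · have h : HasDerivAt (fun t : ℝ => u ⟨p.src.shift p.μ, p.ν⟩ * ρ (Function.update U b (k b t * U b) ⟨p.src.shift p.μ, p.ν⟩))
        (u ⟨p.src.shift p.μ, p.ν⟩ * (if (⟨p.src.shift p.μ, p.ν⟩ : PBond P j) = b then u b * ρ (U b) else 0)) 0 :=
      (hasDerivAt_factor (P := P) (j := j) ρ (k := k b) (X := u b) (hkX b) b ⟨p.src.shift p.μ, p.ν⟩ U).const_mul _
    show HasDerivAt (fun t : ℝ => slotIns ρ u (Function.update U b (k b t * U b)) p 1) (if slotBond p 1 = b then slotIns₂ ρ u U p 1 else 0) 0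
    simp only [slotIns, slotIns₂, slotBond, Matrix.cons_val_one, Matrix.cons_val_zero]
    by_cases hb : (⟨p.src.shift p.μ, p.ν⟩ : PBond P j) = b
    · subst hb; rw [if_pos rfl] at h ⊢; exact h
    · rw [if_neg hb, mul_zero] at h; rw [if_neg hb]; exact h
  · have h : HasDerivAt (fun t : ℝ => ρ ((Function.update U b (k b t * U b) ⟨p.src.shift p.ν, p.μ⟩)⁻¹) * (-u ⟨p.src.shift p.ν, p.μ⟩))
        ((if (⟨p.src.shift p.ν, p.μ⟩ : PBond P j) = b then ρ ((U b)⁻¹) * (-u b) else 0) * (-u ⟨p.src.shift p.ν, p.μ⟩)) 0 :=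
      (hasDerivAt_factor_inv (P := P) (j := j) ρ (k := k b) (X := u b) (hk b) (hkX b) b ⟨p.src.shift p.ν, p.μ⟩ U).mul_const _
    show HasDerivAt (fun t : ℝ => slotIns ρ u (Function.update U b (k b t * U b)) p 2) (if slotBond p 2 = b then slotIns₂ ρ u U p 2 else 0) 0
    simp only [slotIns, slotIns₂, slotBond, Matrix.cons_val]
    by_cases hb : (⟨p.src.shift p.ν, p.μ⟩ : PBond P j) = b
    · subst hb; rw [if_pos rfl] at h ⊢; exact h
    · rw [if_neg hb, zero_mul] at h; rw [if_neg hb]; exact h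
  · have h : HasDerivAt (fun t : ℝ => ρ ((Function.update U b (k b t * U b) ⟨p.src, p.ν⟩)⁻¹) * (-u ⟨p.src, p.ν⟩))
        ((if (⟨p.src, p.ν⟩ : PBond P j) = b then ρ ((U b)⁻¹) * (-u b) else 0) * (-u ⟨p.src, p.ν⟩)) 0 :=
      (hasDerivAt_factor_inv (P := P) (j := j) ρ (k := k b) (X := u b) (hk b) (hkX b) b ⟨p.src, p.ν⟩ U).mul_const _
    show HasDerivAt (fun t : ℝ => slotIns ρ u (Function.update U b (k b t * U b)) p 3) (if slotBond p 3 = b then slotIns₂ ρ u U p 3 else 0) 0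
    simp only [slotIns, slotIns₂, slotBond, Matrix.cons_val]
    by_cases hb : (⟨p.src, p.ν⟩ : PBond P j) = b
    · subst hb; rw [if_pos rfl] at h ⊢; exact h
    · rw [if_neg hb, zero_mul] at h; rw [if_neg hb]; exact h

omit [DecidableEq (PBond P j)] in
/-- A direct link factor along the SIMULTANEOUS flow `U ↦ (e ↦ k e t · U_e)`: derivative `u_e ρ(U_e)`. [cite: Creutz2022, Ch. 11] -/
theorem hasDerivAt_factor_flow (hkX : ∀ b t, ρ (k b t) = exp ((t : ℂ) • u b)) (e : PBond P j) (U : GaugeField P j G) :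
    HasDerivAt (fun t : ℝ => ρ (k e t * U e)) (u e * ρ (U e)) 0 := by
  simp only [map_mul, hkX]
  exact (hasDerivAt_exp_coe_smul (u e)).mul_const _

omit [DecidableEq (PBond P j)] in
/-- An inverse link factor along the simultaneous flow: derivative `ρ(U_e⁻¹)(−u_e)`. [cite: Creutz2022, Ch. 11] -/
theorem hasDerivAt_factor_inv_flow (hk : ∀ b s t, k b (s + t) = k b s * k b t) (hkX : ∀ b t, ρ (k b t) = exp ((t : ℂ) • u b))
    (e : PBond P j) (U : GaugeField P j G) :
    HasDerivAt (fun t : ℝ => ρ ((k e t * U e)⁻¹)) (ρ ((U e)⁻¹) * (-u e)) 0 := by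
  have hfun : (fun t : ℝ => ρ ((k e t * U e)⁻¹)) = fun t : ℝ => ρ ((U e)⁻¹) * exp ((t : ℂ) • (-u e)) := by
    funext t
    rw [mul_inv_rev, ← oneParam_neg (hk e), map_mul, hkX]
    congr 2
    push_cast
    rw [neg_smul, smul_neg]
  rw [hfun]
  exact (hasDerivAt_exp_coe_smul (-u e)).const_mul _

omit [DecidableEq (PBond P j)] in
/-- Simultaneous flow: every slot moves, with derivative the first insertion. [cite: Creutz2022, Ch. 11] -/
theorem hasDerivAt_slot_flow (hk : ∀ b s t, k b (s + t) = k b s * k b t) (hkX : ∀ b t, ρ (k b t) = exp ((t : ℂ) • u b))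
    (U : GaugeField P j G) (p : Plaq P j) (i : Fin 4) :
    HasDerivAt (fun t : ℝ => slot ρ (fun e => k e t * U e) p i) (slotIns ρ u U p i) 0 := by
  fin_cases i
  · show HasDerivAt (fun t : ℝ => slot ρ (fun e => k e t * U e) p 0) (slotIns ρ u U p 0) 0
    simp only [slot, slotIns, Matrix.cons_val_zero]
    exact hasDerivAt_factor_flow (ρ := ρ) (u := u) hkX ⟨p.src, p.μ⟩ U
  · show HasDerivAt (fun t : ℝ => slot ρ (fun e => k e t * U e) p 1) (slotIns ρ u U p 1) 0
    simp only [slot, slotIns, Matrix.cons_val_one, Matrix.cons_val_zero]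
    exact hasDerivAt_factor_flow (ρ := ρ) (u := u) hkX ⟨p.src.shift p.μ, p.ν⟩ U
  · show HasDerivAt (fun t : ℝ => slot ρ (fun e => k e t * U e) p 2) (slotIns ρ u U p 2) 0
    simp only [slot, slotIns, Matrix.cons_val]
    exact hasDerivAt_factor_inv_flow (ρ := ρ) (u := u) hk hkX ⟨p.src.shift p.ν, p.μ⟩ U
  · show HasDerivAt (fun t : ℝ => slot ρ (fun e => k e t * U e) p 3) (slotIns ρ u U p 3) 0
    simp only [slot, slotIns, Matrix.cons_val]
    exact hasDerivAt_factor_inv_flow (ρ := ρ) (u := u) hk hkX ⟨p.src, p.ν⟩ U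

omit [DecidableEq (PBond P j)] in
/-- A multiplicative family starts at `1`. [folklore] -/
theorem flow_zero (hk : ∀ b s t, k b (s + t) = k b s * k b t) (e : PBond P j) : k e 0 = 1 := by
  have h := hk e 0 0
  rw [add_zero] at h
  exact mul_eq_left.1 h.symm

end Slots

end Summit.QuantumFields.YangMills.Theorems.UnitScaleGibbsActionDerivativeSlotCalculus

end
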